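import Mathlib
import HarnessLib
import Summits.Ventures.LatticeQCDFlow.Exactness.SphereCapChaining
import Summits.Ventures.LatticeQCDFlow.Exactness.SphereFamilyLeapfrog

/-!
# Cap chaining on a finite family of spheres — the position space of `cpn_2d.HMCCPN`: a kernel dominating the product of small caps around every configuration has a Doeblin power

HONEST FRAMING: exact (Metropolis-corrected) sampling algorithms for lattice gauge theory;
figures of merit are autocorrelation/cost numbers at stated couplings and volumes; no
continuum-physics claim.

Venture `LatticeQCDFlow` (cell pub-lqcd), topic `Exactness`, FANOUT row 9 (eng-latcore; the covering
half of the `cpn_2d` multi-step programme, lattice form; design in HOME/eng-latcore/HANDOFF.md GEN-19).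
NEW WORK of the cell over the tree (`SphereCapChaining.lean`: the ABSTRACT chaining `chain_cover` and the
one-sphere halfway property; `SphereCapGeometry.lean`: caps; gen-16's `SphereFamilyLeapfrog.lean`: the
family phase space `FamS k i = S^{k i + 1}`) and Mathlib (`Measure.pi_pi`, `Set.pi_inter_distrib`);
nothing is cited as a fact; no number.

THE POINT.  The abstract chaining lemma only needs: measurable symmetric "balls", the halfway property
`μ(B(x, ρ) ∩ B(z, ρ)) ≥ m_ρ > 0` for `z ∈ B(x, 3ρ/2)`, and exhaustion at a finite radius.  Products of caps
`Π_i cap(x_i, ρ)` on `Π_i S^{k_i+1}` with the product of the uniform laws have all three: the halfway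
property holds COORDINATEWISE and the product measure of a product set is the product
(`m = Π_i σ_i(cap(·, ρ/4))`).

* `piCap x ρ = Set.pi univ (i ↦ sphereCap (x i) ρ)`, `measurableSet_piCap_rel`, `piCap_symm`,
  `piCap_eq_univ` (`ρ > π`), **`pi_uniformSphere_piCap_inter_ge`** (the halfway property with
  `m = Π_i σ_i(cap(x₀ i, ρ/4)) ≠ 0`), and
  **`sphereFamily_cap_chaining`**: for a Markov kernel `κ` on `Π_i S^{k_i+1}` with
  `c • (⊗σ)|_{piCap(x, r)} ≤ κ x` for all `x` (`r > 0`, `c ≠ 0`): `∃ k c' ≠ 0, ∀ x, c' • ⊗σ ≤ nHit κ (2^k) x`.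

NOT CLAIMED: the minorisation hypothesis for the engine's multi-step HMC (the analytic half: position law
via `KickedProductTrajectory` in the body frame + a local chart comparison — successor), constants.
-/

noncomputable section

namespace Summit.Ventures.LatticeQCDFlow.Exactness

open MeasureTheory Measure Metric Set Real InnerProductGeometry ProbabilityTheory ProbabilityTheory.Kernel Function
open scoped ENNReal InnerProductSpace

variable {ι : Type*} {k : ι → ℕ}

/-- **The product cap** around a configuration: every coordinate within angle `ρ`. -/
def piCap (x : ∀ i, FamS k i) (ρ : ℝ) : Set (∀ i, FamS k i) := Set.pi univ fun i => sphereCap (x i) ρ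

/-- Membership. -/
theorem mem_piCap {x z : ∀ i, FamS k i} {ρ : ℝ} : z ∈ piCap x ρ ↔ ∀ i, z i ∈ sphereCap (x i) ρ := by
  simp [piCap, Set.mem_pi]

/-- The product relation is symmetric. -/
theorem piCap_symm (ρ : ℝ) (y z : ∀ i, FamS k i) : z ∈ piCap y ρ ↔ y ∈ piCap z ρ := by
  simp only [mem_piCap, mem_sphereCap, angle_comm]

/-- Product caps of radius `> π` are everything. -/
theorem piCap_eq_univ (x : ∀ i, FamS k i) {ρ : ℝ} (h : π < ρ) : piCap x ρ = univ := by
  ext z; simp [mem_piCap, sphereCap_eq_univ _ h]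

variable [Fintype ι]

/-- The product neighbour relation is measurable. -/
theorem measurableSet_piCap_rel (ρ : ℝ) :
    MeasurableSet {p : (∀ i, FamS k i) × (∀ i, FamS k i) | p.2 ∈ piCap p.1 ρ} := by
  have h : {p : (∀ i, FamS k i) × (∀ i, FamS k i) | p.2 ∈ piCap p.1 ρ} =
      ⋂ i, {p | (p.1 i, p.2 i) ∈ {q : FamS k i × FamS k i | q.2 ∈ sphereCap q.1 ρ}} := by
    ext p; simp [mem_piCap]
  rw [h]
  refine MeasurableSet.iInter fun i => ?_
  exact (((measurable_pi_apply i).comp measurable_fst).prodMk ((measurable_pi_apply i).comp measurable_snd))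
    (measurableSet_angle_lt ρ)

/-- **The halfway property of product caps**: for `z ∈ piCap(x, 3ρ/2)`,
`(⊗σ)(piCap(x, ρ) ∩ piCap(z, ρ)) ≥ Π_i σ_i(cap(x₀ i, ρ/4))`. -/
theorem pi_uniformSphere_piCap_inter_ge {ρ : ℝ} (x₀ x z : ∀ i, FamS k i) (hz : z ∈ piCap x (3 / 2 * ρ)) :
    ∏ i, uniformSphere (volume : Measure (FamE k i)) (sphereCap (x₀ i) (ρ / 4)) ≤
      (Measure.pi fun i => uniformSphere (volume : Measure (FamE k i))) (piCap x ρ ∩ piCap z ρ) := by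
  have hcard : ∀ i, 2 ≤ Fintype.card (Fin (k i + 2)) := fun i => by rw [Fintype.card_fin]; omega
  rw [piCap, piCap, ← Set.pi_inter_distrib, Measure.pi_pi]
  exact Finset.prod_le_prod' fun i _ =>
    uniformSphere_cap_inter_cap_ge (hcard i) (x₀ i) (x i) (z i) ((mem_piCap.1 hz) i)

/-- **CAP CHAINING ON A FINITE FAMILY OF SPHERES** (every `S^{k_i + 1}`, `k_i ≥ 0`).  If a Markov kernel on
`Π_i S^{k_i+1}` dominates, from every configuration, `c` times the product uniform law restricted to the
product cap of radius `r` (`r > 0`, `c ≠ 0`), then a power `nHit κ (2^k)` is Doeblin: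
`c' • ⊗σ ≤ nHit κ (2^k) x` for all `x`, `c' ≠ 0`. -/
theorem sphereFamily_cap_chaining [Nonempty (∀ i, FamS k i)]
    {κ : Kernel (∀ i, FamS k i) (∀ i, FamS k i)} {r : ℝ} {c : ℝ≥0∞} (hr : 0 < r) (hc : c ≠ 0)
    (hκ : ∀ x, c • (Measure.pi fun i => uniformSphere (volume : Measure (FamE k i))).restrict (piCap x r) ≤ κ x) :
    ∃ n : ℕ, ∃ c' : ℝ≥0∞, c' ≠ 0 ∧
      ∀ x, c' • (Measure.pi fun i => uniformSphere (volume : Measure (FamE k i))) ≤ nHit κ (2 ^ n) x := by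
  obtain ⟨x₀⟩ := ‹Nonempty (∀ i, FamS k i)›
  have hcard : ∀ i, 2 ≤ Fintype.card (Fin (k i + 2)) := fun i => by rw [Fintype.card_fin]; omega
  refine chain_cover (Measure.pi fun i => uniformSphere (volume : Measure (FamE k i))) piCap (R₀ := π)
    (fun ρ => measurableSet_piCap_rel ρ) (fun ρ y z => piCap_symm ρ y z) (fun ρ hρ => ?_)
    (fun x ρ hρ => piCap_eq_univ x hρ) hr hc hκ
  refine ⟨∏ i, uniformSphere (volume : Measure (FamE k i)) (sphereCap (x₀ i) (ρ / 4)),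
    Finset.prod_ne_zero_iff.2 fun i _ => (uniformSphere_sphereCap_pos (hcard i) (x₀ i) (by positivity)).ne',
    fun x z hz => pi_uniformSphere_piCap_inter_ge x₀ x z hz⟩

end Summit.Ventures.LatticeQCDFlow.Exactness
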